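import Mathlib
import HarnessLib
import Summits.Parity.BatemanHorn.Theses.AlmostPrimeZeros

/-!
# Line `graded-lsd-rouche` — checked skeleton for the crux `LinearCappedRepulsion`
(item stmt-Parity-11327, route `AlmostPrimeZeros`, rank 5, sub-problem Parity/BatemanHorn)

Crux (by name: `Summit.Parity.BatemanHorn.Theses.AlmostPrimeZeros.LinearCappedRepulsion`):
`∃ C, ∀ x ≥ 2, T(x) := Σ_ρ ‖1 − ρ‖⁻² ≤ C`, the sum over the roots (with multiplicity) of the
almost-prime polynomial `P_x(z) = Σ_{0 ≤ n ≤ x} z^{s(n)} ∈ ℂ[z]`, `s(n) = Σ_{p^v ∥ n} min(v, 2)`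
(the calibration `k = 1`, `f = X` of the route's rank-2 crux `SystemZeroRepulsion`).

Notation: `L = log log x`, `w = z − 1`, `r = ‖z − 1‖`, `φ(r) = (1 + r)^{3/2}`,
`λ(z) = ∏_p (1 + z/p + z²/(p(p−1)))·(1 − 1/p)^z` (entire; `λ(0) = λ(1) = 1`; zeros exactly the pairs
`z_p = (−(p−1) ± i√((p−1)(3p+1)))/2`, `|1 − z_p| = p`), `F = λ/Γ` (the Landau–Selberg–Delange limit
`P_x(z) ≈ x (log x)^{z−1} F(z)`), `N(t) = #{ρ : |ρ − 1| ≤ t}`, `T(x) = 2∫ N(t) t⁻³ dt`.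

## The line (idea `graded-lsd-rouche`, ideator 1; TRIAGE-r1-1/2/3: pass, pass, pass — provisional, the card
text was not mounted in any triage jail nor in this one; the lever below is the slug's, as read identically by
all three triagers and by the refuter-rattack analysis on the item)

Lever: the TWO-SIDED Landau–Selberg–Delange law for the capped statistic, GRADED BY RADIUS — an absolute
error `e^{C·φ(‖z−1‖)}·x(log x)^{Re z − 2}` valid as soon as `C(1 + ‖z−1‖) ≤ log log x` (each radius uses
its own grade; the fixed-radius case is Montgomery–Vaughan Thm 7.17/7.18, PROVED in the tree as
`Literature.NumberTheory.LFunctions.MontgomeryVaughan2007_thm_7_18_holds`; the graded version is the same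
proof with the `R`-dependence of every constant kept, `R ≍ L/C`) — with the EXPLICIT main term
`x (log x)^{z−1} λ(z)/Γ(z)`. Its upper half, divided by the tilt `x e^{L·Re(z−1)}`, is a pointwise
subquadratic majorant `|F(z)| + e^{Cφ}/log x ≤ e^{C'φ(r)}` on the disc `r ≤ L/C − 1` WHATEVER the sign of
`|F| − error` (so the "log L trap" of zero TRACKING never arises: TRIAGE S3/G4); Jensen's formula with the
circle MEAN at the free centre `z = 1` (`P_x(1) = x + 1` exactly; the harmonic exponent `L·Re w` has mean 0)
converts it into `N(t) ≪ φ(et)`, a zero-free disc at `1` (Blaschke), and `Σ_{|ρ−1| ≤ L/(Ce)} ≤ K`; the far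
zeros are counted by positivity of the coefficients + the Rankin/Hall–Tenenbaum real-axis majorant
(`N(t) ≤ etL + O(t)`, tail `≤ 2e²·(2C) + O(1)`). The Rouché layer of the idea (tracking the near zeros to
`−m` and `z_p, z̄_p`, which identifies `lim T(x) = π²/6 + 2Σ_p p⁻² = 2.5494`) is NOT load-bearing for the
`∃ C` crux and, per triage, must not be asserted on the full disc from an absolute-error law; it is recorded
in the line card as the optional follow-on this two-sided stub (and only a two-sided stub) enables.

## Stubs (4) and composition

* S1 `stub_gradedLSD` — THE ENGINE (hardest, L): the radius-graded two-sided law with explicit main term.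
* S2 `stub_limitEnvelope` — growth of the limit: `‖λ(z)/Γ(z)‖ ≤ e^{C(1+‖z−1‖)^{3/2}}` on `ℂ` (M; Euler
  product estimate `log|λ| = O(|z| log log|z|)` + `log|1/Γ| = O(|z| log|z|)`, e.g. by the tree's Hankel loop).
* S3 `stub_rankinMajorant` — real-axis majorant `Σ_{n≤x}(1+r)^{s(n)} ≤ B x e^{Lr + Bφ(r)}` (M; Hall–Tenenbaum
  Thm 01 = `Literature.NumberTheory.LFunctions.HallTenenbaumTheorem01.theorem01`, PROVED, + Chebyshev/Mertens).
* S4 `stub_jensenConversion` — pure complex analysis over `Polynomial ℂ` (M; VERBATIM the `JensenConversion`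
  of line `harmonic-majorant-jensen`, `SketchIdeator2.lean`, so ONE proof serves both lines; verified TRUE as
  typed by TRIAGE-r1-1 and r1-2): disc majorant with harmonic exponent + crude global majorant ⇒ `T ≤ K(a,b,k₀)`.

Composition (sorry-free, kernel-checked): `repulsion_of_parts` (the four statements as hypotheses ⇒ the crux
body: threshold `x₁ = max 3 ⌈exp(exp(2C₁))⌉`, finitely many `x < x₁` by `Σ_{y<x₁} T(y)`, for `x ≥ x₁`:
`Λ = L`, `R₁ = L/C₁ − 1 ≥ 1`, `k₀ = 2C₁`, disc majorant from S1 at the point's own grade + S2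
(`e^{c₂φ} + e^{C₁φ} ≤ e^{(C₁+c₂+1)φ}`), global majorant from `‖P_x(z)‖ ≤ P_x(1 + ‖z−1‖)` + S3
(`b·e^{u+Bφ} ≤ e^{u+2bφ}`)), and `LinearCappedRepulsion_of : LinearCappedRepulsion` BY NAME.

## Disproof.lean / negatives — what this skeleton honours

`disproof_path` is not mounted in this jail; used through its evidence notes on the item (cdisprove rev 1–3):
(i) `def UniformUpperBound R η` — "the crux follows by Jensen ALONE from a one-sided bound with growth
`exp(C(|z|+2)^η)`, any `η < 2`": S1's upper half is exactly such a bound with `η = 3/2` on `R(x) = L/C`, and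
S4 is that Jensen step — the line uses the cap-dependent LSD input at S1 (`…_false_without_cap`, the sorried
near-miss: for `Ω` the circle `|z| = 2` carries `≍ log x` zeros and `T ≍ log x` — S1 is FALSE for the uncapped
statistic already at fixed radius 2, MV (7.60) `R < 2`, so no stub here is an instance of it); (ii) "the Rouché
route has a log L trap" — no stub asserts tracking or main-term dominance; (iii) `linearCappedRepulsion_iff_all_x`
(`2 ≤ x` decorative) and "T not monotone" — the composition never uses monotonicity and absorbs every `x < x₁`
by a finite sum; (iv) refuted strengthenings (monotone `T`, real-rootedness) — not used. No `Negative/` lemma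
has landed for this crux (only for `SystemLSDRealSegment`); `ledger negatives --problem Parity` (3 items, all
GeneralizedHardyLittlewood) — unrelated. Numerics of THIS line (kit j007683, attached to the item): the typed
main term is right — `S/M → 1` at the rate `1/log x` (`z = 1/2`: 1.0294, 1.0238, 1.0202 at `x = 10⁵,10⁶,10⁷`,
i.e. `(S/M − 1)·log x = 0.33, 0.33, 0.32`; `z = 2`: `0.076, 0.076, 0.076`), `λ(1) = λ(0) = 1`, `λ(z₂) ≈ 10⁻¹⁶`,
and `max_θ log|F(1 + re^{iθ})| / (1+r)^{3/2} ≤ 1.15` for all `r ≤ 32` (S2's shape).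
-/

noncomputable section

namespace Summit.Parity.BatemanHorn.Cruxes.LinearCappedRepulsion.GradedLsdRouche

open scoped BigOperators
open Summit.Parity.BatemanHorn.Theses.AlmostPrimeZeros (LinearCappedRepulsion)

/-! ## §0 Read-back of the crux (definitional) -/

/-- The crux is, verbatim, the boundedness of `T(x) = Σ_ρ ‖1−ρ‖⁻²` over the roots of
`Σ_{n ≤ x} X^{s(n)}` (`Iff.rfl`; anti-costume check: no stub below has this shape — S1–S3 are statements
about values of `P_x`, `λ/Γ` and a real sum, S4 is a lemma about arbitrary complex polynomials). -/
theorem crux_iff :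
    LinearCappedRepulsion ↔
      ∃ C : ℝ, ∀ x : ℕ, 2 ≤ x → ((∑ n ∈ Finset.range (x + 1), (Polynomial.X : Polynomial ℂ) ^
        (n.factorization.sum fun _ v => min v 2)).roots.map
          (fun ρ : ℂ => (‖(1 : ℂ) - ρ‖ ^ 2)⁻¹)).sum ≤ C :=
  Iff.rfl

/-! ## §1 The stubs (`sorry` lives ONLY here) -/

/-- **S1 — THE ENGINE (hardest, size L): the radius-graded two-sided Landau–Selberg–Delange law for the
capped statistic, with the explicit main term.** There is `C > 0` such that for all `x ≥ 3` and all complex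
`z` in the graded range `C·(1 + ‖z − 1‖) ≤ log log x`,
`‖Σ_{0≤n≤x} z^{s(n)} − x·e^{(z−1) log log x}·λ(z)·Γ(z)⁻¹‖ ≤ e^{C(1+‖z−1‖)^{3/2}} · x · e^{(Re z − 1) log log x} / log x`,
i.e. `P_x(z) = x(log x)^{z−1}(λ(z)/Γ(z) + E)`, `|E| ≤ e^{Cφ(‖z−1‖)}/log x`, where
`λ(z) = ∏_p (1 + z/p + z²/(p(p−1)))·exp(z·log(1 − 1/p))` (the value `F(1,z)` of the Euler product
`F(s,z) = Σ_n z^{s(n)} n^{−s} · ζ(s)^{−z} = ∏_p (1 + z p^{−s} + z² p^{−2s}(1 − p^{−s})⁻¹)(1 − p^{−s})^z`,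
an absolutely convergent product of factors `1 + O(|z|²/p²)`, entire in `z`; written as a `tprod` over
`Nat.Primes`, multipliable by `Summable ‖·‖` of the factor minus one) and `Γ(z)⁻¹` is Mathlib's
`(Complex.Gamma z)⁻¹` (`= 0` at the poles, the entire `1/Γ`).
GRADING: the natural constant at radius `R = 1 + ‖z−1‖` is `e^{O(R log R)}`; the stub asks only
`e^{C R^{3/2}}` (any exponent `< 2` feeds S4 — TRIAGE-r1-3 sharpening; it also lets the port keep the tree's
`RieszData` with a FIXED `σ₁ ∈ (2/3, 1)`, where `log sup_{σ>σ₁}|F(s,z)| = O(R^{1/σ₁}/log R)`).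
FIXED-RADIUS CASE = PRINT = TREE: Montgomery–Vaughan Thm 7.18 for `b_z` supported on squarefull `m`
(`b_z(p) = 0`, so the hypothesis `Σ|b_z(m)|(log m)^{2R+1}/m < ∞` holds for EVERY `R`: no `R < 2` wall, the
local factor is a polynomial in `z`), PROVED as `MontgomeryVaughan2007_thm_7_18_holds`
(`SelbergDelangeTheoremHolds.lean`; engine `SelbergDelange.exists_riesz_expansion`,
`SelbergDelangeRieszExpansion.lean`, whose proof already assembles its constant `Ctot` from
`exists_norm_zetaPow_le_far R` (`exp(R·C₀)(log(|t|+3))^R`), `exists_norm_exp_mul_logZeta₁_le R` (`exp(R·M)`),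
`hankelLoop_sub_le (R+N)`, `norm_keyhole_sub_sum_le R N`, with `T = (log x)^κ`, `κ = 2R+N+1`,
`b = 1 − 2c̄/log(T+3)`).
PROOF PLAN (the graded port, nothing new in analysis): (1) `RieszData R σ₁ B(R) z a F(·,z)` for
`a(n) = z^{s(n)}` with `σ₁ = 3/4`, `B(R) = e^{O(R^{4/3})}` (majorant `Σ|z|^{s(n)}n^{−σ} ≤ ζ(σ)^R·e^{O(R)}
≤ 2^R e^{O(R)}(σ−1)^{−R}`); (2) `exists_riesz_expansion` with its `C(R,N)`, `x₀(R,N)` made EXPLICIT: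
`C ≤ B·e^{O((R+N) log(R+N+2))}` and — because the contour saving is `x^{−2c̄/log(T+3)} = exp(−2c̄ log x/(κ log log x))`
— only `log log x₀ = O(log(R+N))`, far inside the stub's range `log log x ≥ C(1+‖z−1‖)`; (3) de-smoothing as in
`SelbergDelangeOmega.norm_summatory_sub_le` (`h = x(log x)^{−2R−1}`, second difference of the non-negative
majorant's Riesz mean `B₁`, expansion order `N = ⌈4R⌉ + 3`; NOT the printed `d_R`-hyperbola short-interval step
of MV p. 177, the one printed step that is not uniform in `R ≍ L` — TRIAGE-r1-1 (iii), r1-2 S2(iv), r1-3 (2));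
(4) collapse the `N`-term expansion to the `N = 0` shape: the terms `k ≥ 1`,
`coeff_k(z)Γ(z−k)⁻¹(log x)^{z−1−k}`, are `≤ e^{O((R+k)log(R+k))}(log x)^{Re z−1−k} ≤ e^{O(R log R)}(log x)^{Re z−2}`
in the graded range (`(R+k)^{O(R+k)} ≤ (log x)^{k−1}` there); (5) `coeff 0 = F(1,z)·(kernel at 1)`,
`F(1,z) = λ(z)`; the `n = 0` term of `P_x` (`z⁰ = 1`) is inside the error. Small `x` never enter (the
hypothesis forces `log log x ≥ C`).
WHY PLAUSIBLY TRUE: every loss in (1)–(4) is `e^{O(R^{4/3})}`–`e^{O(R log R)}`, the savings are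
`exp(−c log x/(R log log x))`, and the two meet only at `R ≍ √(log x)/log log x ≫ L/C` (independent re-traces:
TRIAGE-r1-1 G4, r1-2 S2, r1-3 S2; cdisprove's bookkeeping reached `η = 4/3 < 3/2`). NUMERICS (j007683): main
term exact to `O(1/log x)` at `z = 1/2, 3/2, 2, i, 1+i` for `x = 10⁵…10⁷`; the graded regime itself
(`R ≍ L ≫ 1`) is out of computational reach (`L ≤ 2.8`), numerics can only fail to kill here and do.
NOT IN PRINT as stated (MV Thm 7.17/7.18, Tenenbaum II.5 Thm 5.2: `|z| ≤ R` fixed; de la Bretèche–Tenenbaum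
arXiv:2010.12929: other hypotheses) — grounders g19-14/g20-34/g20-30. Sources: MontgomeryVaughan2007 §7.4
pp. 177–179; Tenenbaum2015 II.5 §§5.1–5.4; Selberg1954. -/
theorem stub_gradedLSD :
    ∃ C : ℝ, 0 < C ∧ ∀ x : ℕ, 3 ≤ x → ∀ z : ℂ,
      C * (1 + ‖z - 1‖) ≤ Real.log (Real.log x) →
      ‖(∑ n ∈ Finset.range (x + 1), z ^ (n.factorization.sum fun _ v => min v 2)) -
          (x : ℂ) * Complex.exp ((z - 1) * (Real.log (Real.log x) : ℂ)) *
            ((∏' p : Nat.Primes, (1 + z / ((p : ℕ) : ℂ) + z ^ 2 / (((p : ℕ) : ℂ) * (((p : ℕ) : ℂ) - 1))) *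
                Complex.exp (z * (Real.log (1 - 1 / ((p : ℕ) : ℝ)) : ℂ))) *
              (Complex.Gamma z)⁻¹)‖ ≤
        Real.exp (C * (1 + ‖z - 1‖) ^ (3 / 2 : ℝ)) * x *
          Real.exp ((z.re - 1) * Real.log (Real.log x)) / Real.log x := by
  sorry

/-- **S2 — growth envelope of the limit function (size M, provable now).** For all complex `z`,
`‖λ(z)·Γ(z)⁻¹‖ ≤ exp(C (1 + ‖z − 1‖)^{3/2})`, `λ` the Euler product of S1 (same `tprod`, verbatim).
Proof plan: (a) `log‖λ(z)‖ ≤ R log log(R+3) + O(R)` for `‖z‖ ≤ R` — primes `p ≤ R`: `|1 + z/p + z²/(p(p−1))| ≤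
3R²/p`-type bounds summed with Chebyshev (`Σ_{p≤R}(2 log R − log p) = O(R)`), and `|(1−1/p)^z| = (1−1/p)^{Re z}
≤ e^{R(1/p + 1/p²)}` summed by Mertens (`Literature.NumberTheory.LFunctions.Mertens.tendsto_primeRecipSum_sub_loglog`,
or any crude `Σ_{p≤R} 1/p ≤ log log R + O(1)`); primes `p > R`: the factor is `1 + O(R²/p²)` after the
first-order cancellation (`(1 + z/p + …)e^{−z/p − z/(2p²) − …}`), `Σ_{p>R} R²/p² = O(R/log R)`; (b)
`log‖Γ(z)⁻¹‖ ≤ c(1 + ‖z‖) log(‖z‖ + 2)` — e.g. from Hankel's representation `Γ(z)⁻¹ = (2πi)⁻¹∫_H e^u u^{−z} du`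
(tree: `Literature/Analysis/Complex/HankelLoopIntegral.lean`) bounded by `e^{π|Im z|}(2πe + 2Γ(1+|Re z|))/2π`, or
from the reflection formula + `|Γ(w)| ≤ Γ(Re w)` on `Re w ≥ 1/2` (Mathlib `Complex.Gamma_mul_Gamma_one_sub`,
`Complex.Gamma` integral); Mathlib's junk `Γ(−n) = 0` gives `Γ(−n)⁻¹ = 0`, the true value of the entire `1/Γ`.
(c) `R log log(R+3) + (1+R) log(R+2) ≤ C(1+r)^{3/2}` with `R ≤ 1 + r`. NUMERICS (j007683):
`max_θ log‖F(1 + re^{iθ})‖/(1+r)^{3/2} = 0.09, 0.24, 0.44, 0.60, 0.83, 1.06, 1.13, 1.15, 1.12, 1.04, 0.97` at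
`r = ¼, 1, 2, 3, 4, 6, 8, 12, 16, 24, 32` (the sharp shape is `(1+r)log(r+2)`, ratio `≤ 1.60`). Leans on:
`Complex.Gamma`, `Complex.differentiable_one_div_Gamma`, `tprod`/`Multipliable` API
(`multipliable_one_add_of_summable`-type lemmas), `Nat.Primes`, Chebyshev bounds (`Mathlib.NumberTheory.Chebyshev`). -/
theorem stub_limitEnvelope :
    ∃ C : ℝ, ∀ z : ℂ,
      ‖(∏' p : Nat.Primes, (1 + z / ((p : ℕ) : ℂ) + z ^ 2 / (((p : ℕ) : ℂ) * (((p : ℕ) : ℂ) - 1))) *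
            Complex.exp (z * (Real.log (1 - 1 / ((p : ℕ) : ℝ)) : ℂ))) *
          (Complex.Gamma z)⁻¹‖ ≤
        Real.exp (C * (1 + ‖z - 1‖) ^ (3 / 2 : ℝ)) := by
  sorry

/-- **S3 — the Rankin / Hall–Tenenbaum real-axis majorant (size M, provable now).** There is `B` with
`Σ_{0≤n≤x} (1+r)^{s(n)} ≤ B·x·exp(r·log log x + B(1+r)^{3/2})` for all `x ≥ 3`, `r ≥ 0` (so, by positivity
of the coefficients, `max_{|z−1|=r}|P_x(z)| = P_x(1+r) ≤ B x (log x)^{r} e^{Bφ(r)}` — all the FAR zeros need).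
Proof plan (`y = 1 + r ≥ 1`): `n ↦ y^{s(n)}` is multiplicative, non-negative, `f(p) = y`, `f(p^v) = y²`
(`v ≥ 2`); Hall–Tenenbaum Thm 01 (`Literature.NumberTheory.LFunctions.HallTenenbaumTheorem01.theorem01`, PROVED,
explicit constant `A + B + 1` with `A = y·log 4` from Chebyshev `θ(t) ≤ t log 4` and
`B_HT = y² Σ_p Σ_{v≥2} v log p/p^v = O(y²)`) gives `Σ_{n≤x} y^{s(n)} ≤ (A + B_HT + 1)(x/log x) Σ_{n≤x} y^{s(n)}/n
≤ c y² (x/log x) ∏_{p≤x}(1 + y/p + 2y²/p²)`, and `Σ_{p≤x} log(1 + y/p + 2y²/p²) ≤ y·log log x + O(y)` UNIFORMLY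
(`p ≤ min(x,y)`: `≤ log(4y²/p²)`, summed `O(y)` by Chebyshev; `y < p`: `≤ y/p + 2y²/p²`, Mertens) — no `y²`
in the exponent; total `x e^{r log log x} e^{O(1+r) + 2 log(1+r)} ≤ B x e^{rL + B(1+r)^{3/2}}`; the `n = 0, 1`
terms contribute `2`. (Weaker than, hence implied by, `RankinMajorant` of line harmonic-majorant-jensen, whose loss
is `e^{By log(y+1)}`.) Sources: HallTenenbaum1988 Thm 01 (0.7) p. 10; Tenenbaum2015 III.3.5. Leans on:
`HallTenenbaumTheorem01.theorem01`, `Nat.factorization`, Chebyshev/Mertens facts of the tree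
(`Literature.NumberTheory.LFunctions.Mertens.*`, `MertensFromChebyshev.lean`). -/
theorem stub_rankinMajorant :
    ∃ B : ℝ, ∀ x : ℕ, 3 ≤ x → ∀ r : ℝ, 0 ≤ r →
      ∑ n ∈ Finset.range (x + 1), (1 + r) ^ (n.factorization.sum fun _ v => min v 2) ≤
        B * x * Real.exp (Real.log (Real.log x) * r + B * (1 + r) ^ (3 / 2 : ℝ)) := by
  sorry

/-- **S4 — Jensen with the circle MEAN at the free centre (pure complex analysis, size M, provable now;
VERBATIM the `JensenConversion` of `Cruxes/LinearCappedRepulsion/SketchIdeator2.lean`, line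
harmonic-majorant-jensen — one proof serves both lines).** For `P ∈ ℂ[z]` with `P(1) ≠ 0`: a majorant on the
disc `‖z−1‖ ≤ R₁` of the form `‖P(1)‖·exp(Λ·Re(z−1) + a(1+‖z−1‖)^{3/2})` (harmonic exponential × subquadratic
loss) together with a crude global majorant `‖P(1)‖·exp(Λ‖z−1‖ + b(1+‖z−1‖)^{3/2})` and `0 ≤ Λ ≤ k₀R₁`, `R₁ ≥ 1`,
bounds `Σ_ρ ‖1−ρ‖⁻²` by a constant depending on `a, b, k₀` only. Proof plan (verified on paper by TRIAGE-r1-1 and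
r1-2): with `g(w) = P(1+w)e^{−Λw}/P(1)` (entire, `g(0) = 1`, same zeros shifted by 1): `|g| ≤ e^{aφ(|w|)}` on
`|w| ≤ R₁` (the tilt cancels the harmonic exponent POINTWISE) and circle-mean `log|g| ≤ Λt + bφ(t)` on `|w| = t`
(mean of `−Λ Re w` is `0`); Jensen `Σ_{|w_ρ|<et} log(et/|w_ρ|) = mean_{|w|=et} log|g|` gives `N(t) ≤ aφ(et)` for
`et ≤ R₁` and `N(t) ≤ eΛt + bφ(et)` always; Jensen at radius `1 ≤ R₁` gives the zero-free disc
`|w_ρ| ≥ e^{−a·2^{3/2}}`; Stieltjes `Σ|w_ρ|⁻² = 2∫_{r₀}^∞ N(t)t⁻³dt ≤ K₁(a) + 2e²k₀ + K₂(b)`; `a < 0` or `b < 0`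
make the hypotheses fail at `z = 1` (vacuous). Leans on: Mathlib `circleAverage_log_norm` (Jensen's formula),
`MeromorphicOn.divisor`, `Polynomial.roots`, `IsAlgClosed.splits`; tree
`Literature.Analysis.Complex.sum_divisor_le_of_circleAverage_le`, `circleAverage_re_eq` (Jensen-with-mean, PROVED).
Sources: Jensen1899; Titchmarsh1986 §9.4; Tenenbaum2015 II.5. -/
theorem stub_jensenConversion :
    ∀ a b k₀ : ℝ, ∃ K : ℝ, ∀ (P : Polynomial ℂ) (Λ R₁ : ℝ), P.eval 1 ≠ 0 → 1 ≤ R₁ → 0 ≤ Λ →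
      Λ ≤ k₀ * R₁ →
      (∀ z : ℂ, ‖z - 1‖ ≤ R₁ →
        ‖P.eval z‖ ≤ ‖P.eval 1‖ * Real.exp (Λ * (z.re - 1) + a * (1 + ‖z - 1‖) ^ (3 / 2 : ℝ))) →
      (∀ z : ℂ, ‖P.eval z‖ ≤ ‖P.eval 1‖ * Real.exp (Λ * ‖z - 1‖ + b * (1 + ‖z - 1‖) ^ (3 / 2 : ℝ))) →
      (P.roots.map (fun ρ : ℂ => (‖(1 : ℂ) - ρ‖ ^ 2)⁻¹)).sum ≤ K := by
  sorry

/-! ## §2 Composition (sorry-free) -/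

/-- `P_x(1) = x + 1` (every exponent evaluates to `1`). [folklore] -/
theorem eval_one_eq (x : ℕ) :
    (∑ n ∈ Finset.range (x + 1), (Polynomial.X : Polynomial ℂ) ^
        (n.factorization.sum fun _ v => min v 2)).eval 1 = (x : ℂ) + 1 := by
  simp [Polynomial.eval_finsetSum]

/-- `P_x(z) = Σ_{n ≤ x} z^{s(n)}`. [folklore] -/
theorem eval_eq (x : ℕ) (z : ℂ) :
    (∑ n ∈ Finset.range (x + 1), (Polynomial.X : Polynomial ℂ) ^
        (n.factorization.sum fun _ v => min v 2)).eval z =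
      ∑ n ∈ Finset.range (x + 1), z ^ (n.factorization.sum fun _ v => min v 2) := by
  simp [Polynomial.eval_finsetSum]

/-- Two exponentials absorbed into one: `e^{c₂φ} + e^{c₁φ} ≤ e^{(c₁+c₂+1)φ}` for `c₁, c₂ ≥ 0`, `φ ≥ 1`. [folklore] -/
theorem exp_add_exp_le {c₁ c₂ φ : ℝ} (h₁ : 0 ≤ c₁) (h₂ : 0 ≤ c₂) (hφ : 1 ≤ φ) :
    Real.exp (c₂ * φ) + Real.exp (c₁ * φ) ≤ Real.exp ((c₁ + c₂ + 1) * φ) := by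
  have hφ0 : 0 ≤ φ := le_trans zero_le_one hφ
  have e1 : Real.exp (c₂ * φ) ≤ Real.exp ((c₁ + c₂) * φ) :=
    Real.exp_le_exp.2 (by nlinarith)
  have e2 : Real.exp (c₁ * φ) ≤ Real.exp ((c₁ + c₂) * φ) :=
    Real.exp_le_exp.2 (by nlinarith)
  have e3 : (2 : ℝ) ≤ Real.exp φ := by
    have := Real.add_one_le_exp φ
    linarith
  calc Real.exp (c₂ * φ) + Real.exp (c₁ * φ)
      ≤ 2 * Real.exp ((c₁ + c₂) * φ) := by linarith
    _ ≤ Real.exp φ * Real.exp ((c₁ + c₂) * φ) := by gcongr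
    _ = Real.exp ((c₁ + c₂ + 1) * φ) := by rw [← Real.exp_add]; ring_nf

/-- A prefactor absorbed into the exponent: `b·e^{u + Bφ} ≤ e^{u + 2bφ}` for `B ≤ b`, `1 ≤ b`, `1 ≤ φ`. [folklore] -/
theorem mul_exp_le {b B u φ : ℝ} (hB : B ≤ b) (hb : 1 ≤ b) (hφ : 1 ≤ φ) :
    b * Real.exp (u + B * φ) ≤ Real.exp (u + 2 * b * φ) := by
  have hb0 : 0 ≤ b := le_trans zero_le_one hb
  have hφ0 : 0 ≤ φ := le_trans zero_le_one hφ
  have h1 : b ≤ Real.exp (b * φ) := by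
    calc b ≤ b * φ := le_mul_of_one_le_right hb0 hφ
      _ ≤ b * φ + 1 := by linarith
      _ ≤ Real.exp (b * φ) := Real.add_one_le_exp _
  have h2 : Real.exp (u + B * φ) ≤ Real.exp (u + b * φ) := Real.exp_le_exp.2 (by nlinarith)
  calc b * Real.exp (u + B * φ) ≤ Real.exp (b * φ) * Real.exp (u + b * φ) := by
        gcongr
    _ = Real.exp (u + 2 * b * φ) := by rw [← Real.exp_add]; ring_nf

/-- **The composition, with the four stub STATEMENTS as hypotheses (sorry-free): graded law + envelope +
Rankin + Jensen conversion ⇒ the crux body.** Bookkeeping only: constants `c₂ = max C₂ 0`, `b = max B 1`,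
conversion parameters `(a, b', k₀) = (C₁ + c₂ + 1, 2b, 2C₁)`; threshold `x₁ = max 3 ⌈exp(exp(2C₁))⌉₊`
(so `log log x ≥ 2C₁` beyond it); the finitely many `x < x₁` are bounded by `Σ_{y<x₁} T(y)` (each `T(y) ≥ 0`
is a finite sum); for `x ≥ x₁`: `Λ = log log x`, `R₁ = Λ/C₁ − 1 ≥ 1`, `Λ ≤ 2C₁R₁`; on `‖z−1‖ ≤ R₁` the
point's own grade is valid (`C₁(1+‖z−1‖) ≤ C₁(1+R₁) = Λ`), so S1 + S2 give
`‖P_x(z)‖ ≤ x e^{(Re z−1)Λ}(e^{c₂φ} + e^{C₁φ}) ≤ (x+1)e^{Λ(Re z−1)}e^{(C₁+c₂+1)φ}`; everywhere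
`‖P_x(z)‖ ≤ Σ‖z‖^{s(n)} ≤ Σ(1+‖z−1‖)^{s(n)} ≤ Bxe^{Λr+Bφ} ≤ (x+1)e^{Λr+2bφ}` by S3. -/
theorem repulsion_of_parts
    (hL : ∃ C : ℝ, 0 < C ∧ ∀ x : ℕ, 3 ≤ x → ∀ z : ℂ,
      C * (1 + ‖z - 1‖) ≤ Real.log (Real.log x) →
      ‖(∑ n ∈ Finset.range (x + 1), z ^ (n.factorization.sum fun _ v => min v 2)) -
          (x : ℂ) * Complex.exp ((z - 1) * (Real.log (Real.log x) : ℂ)) *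
            ((∏' p : Nat.Primes, (1 + z / ((p : ℕ) : ℂ) + z ^ 2 / (((p : ℕ) : ℂ) * (((p : ℕ) : ℂ) - 1))) *
                Complex.exp (z * (Real.log (1 - 1 / ((p : ℕ) : ℝ)) : ℂ))) *
              (Complex.Gamma z)⁻¹)‖ ≤
        Real.exp (C * (1 + ‖z - 1‖) ^ (3 / 2 : ℝ)) * x *
          Real.exp ((z.re - 1) * Real.log (Real.log x)) / Real.log x)
    (hE : ∃ C : ℝ, ∀ z : ℂ,
      ‖(∏' p : Nat.Primes, (1 + z / ((p : ℕ) : ℂ) + z ^ 2 / (((p : ℕ) : ℂ) * (((p : ℕ) : ℂ) - 1))) *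
            Complex.exp (z * (Real.log (1 - 1 / ((p : ℕ) : ℝ)) : ℂ))) *
          (Complex.Gamma z)⁻¹‖ ≤
        Real.exp (C * (1 + ‖z - 1‖) ^ (3 / 2 : ℝ)))
    (hR : ∃ B : ℝ, ∀ x : ℕ, 3 ≤ x → ∀ r : ℝ, 0 ≤ r →
      ∑ n ∈ Finset.range (x + 1), (1 + r) ^ (n.factorization.sum fun _ v => min v 2) ≤
        B * x * Real.exp (Real.log (Real.log x) * r + B * (1 + r) ^ (3 / 2 : ℝ)))
    (hJ : ∀ a b k₀ : ℝ, ∃ K : ℝ, ∀ (P : Polynomial ℂ) (Λ R₁ : ℝ), P.eval 1 ≠ 0 → 1 ≤ R₁ → 0 ≤ Λ →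
      Λ ≤ k₀ * R₁ →
      (∀ z : ℂ, ‖z - 1‖ ≤ R₁ →
        ‖P.eval z‖ ≤ ‖P.eval 1‖ * Real.exp (Λ * (z.re - 1) + a * (1 + ‖z - 1‖) ^ (3 / 2 : ℝ))) →
      (∀ z : ℂ, ‖P.eval z‖ ≤ ‖P.eval 1‖ * Real.exp (Λ * ‖z - 1‖ + b * (1 + ‖z - 1‖) ^ (3 / 2 : ℝ))) →
      (P.roots.map (fun ρ : ℂ => (‖(1 : ℂ) - ρ‖ ^ 2)⁻¹)).sum ≤ K) :
    ∃ C : ℝ, ∀ x : ℕ, 2 ≤ x → ((∑ n ∈ Finset.range (x + 1), (Polynomial.X : Polynomial ℂ) ^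
        (n.factorization.sum fun _ v => min v 2)).roots.map
          (fun ρ : ℂ => (‖(1 : ℂ) - ρ‖ ^ 2)⁻¹)).sum ≤ C := by
  obtain ⟨C₁, hC₁, hL⟩ := hL
  obtain ⟨C₂, hE⟩ := hE
  obtain ⟨B, hR⟩ := hR
  have hC₁0 : 0 ≤ C₁ := hC₁.le
  -- constants fed to the conversion lemma
  set c₂ : ℝ := max C₂ 0 with hc₂
  have hc₂0 : 0 ≤ c₂ := le_max_right _ _
  set b : ℝ := max B 1 with hb
  have hb1 : 1 ≤ b := le_max_right _ _
  have hBb : B ≤ b := le_max_left _ _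
  obtain ⟨K, hK⟩ := hJ (C₁ + c₂ + 1) (2 * b) (2 * C₁)
  -- the zero statistic as a function of x, and its nonnegativity
  set T : ℕ → ℝ := fun x => ((∑ n ∈ Finset.range (x + 1), (Polynomial.X : Polynomial ℂ) ^
        (n.factorization.sum fun _ v => min v 2)).roots.map
          (fun ρ : ℂ => (‖(1 : ℂ) - ρ‖ ^ 2)⁻¹)).sum with hT
  have hT0 : ∀ x, 0 ≤ T x := fun x => Multiset.sum_nonneg (fun t ht => by
      obtain ⟨ρ, _, rfl⟩ := Multiset.mem_map.1 ht
      positivity)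
  -- threshold beyond which log log x ≥ 2 C₁, and the finitely many x below it
  set x₁ : ℕ := max 3 ⌈Real.exp (Real.exp (2 * C₁))⌉₊ with hx₁
  set C₀ : ℝ := ∑ y ∈ Finset.range x₁, T y with hC₀
  refine ⟨max C₀ K, fun x _hx2 => ?_⟩
  show T x ≤ max C₀ K
  rcases lt_or_ge x x₁ with hsmall | hsmall
  · have : T x ≤ C₀ := Finset.single_le_sum (fun y _ => hT0 y) (Finset.mem_range.2 hsmall)
    exact this.trans (le_max_left _ _)
  have hx3 : 3 ≤ x := le_trans (le_max_left _ _) hsmall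
  have hxceil : ⌈Real.exp (Real.exp (2 * C₁))⌉₊ ≤ x := le_trans (le_max_right _ _) hsmall
  have hxR : Real.exp (Real.exp (2 * C₁)) ≤ (x : ℝ) := Nat.ceil_le.1 hxceil
  have hx0 : (0 : ℝ) < x := by exact_mod_cast (show 0 < x by omega)
  have hlogx : Real.exp (2 * C₁) ≤ Real.log x := (Real.le_log_iff_exp_le hx0).2 hxR
  have hlogx_pos : 0 < Real.log x := lt_of_lt_of_le (Real.exp_pos _) hlogx
  have hlogx1 : 1 ≤ Real.log x := by
    have h3 : Real.exp 1 ≤ (3 : ℝ) := by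
      have := Real.exp_one_lt_d9
      linarith
    have : Real.exp 1 ≤ (x : ℝ) := h3.trans (by exact_mod_cast hx3)
    exact (Real.le_log_iff_exp_le hx0).2 this
  set Λ : ℝ := Real.log (Real.log x) with hΛ
  have hΛ2 : 2 * C₁ ≤ Λ := (Real.le_log_iff_exp_le hlogx_pos).2 hlogx
  have hΛ0 : 0 ≤ Λ := le_trans (by positivity) hΛ2
  set R₁ : ℝ := Λ / C₁ - 1 with hR₁
  have hR₁1 : 1 ≤ R₁ := by
    rw [hR₁, le_sub_iff_add_le, le_div_iff₀ hC₁]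
    linarith
  have hC₁R₁ : C₁ * (1 + R₁) = Λ := by
    rw [hR₁]; field_simp; ring
  have hΛk : Λ ≤ 2 * C₁ * R₁ := by
    have : 2 * C₁ * R₁ = 2 * Λ - 2 * C₁ := by rw [hR₁]; field_simp
    rw [this]; linarith
  -- the polynomial and its value at 1
  set P : Polynomial ℂ := ∑ n ∈ Finset.range (x + 1), (Polynomial.X : Polynomial ℂ) ^
        (n.factorization.sum fun _ v => min v 2) with hP
  have hP1 : P.eval 1 = (x : ℂ) + 1 := eval_one_eq x
  have hP1norm : ‖P.eval 1‖ = (x : ℝ) + 1 := by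
    rw [hP1]; exact_mod_cast Complex.norm_natCast (x + 1)
  have hP1ne : P.eval 1 ≠ 0 := by
    rw [hP1]; exact Nat.cast_add_one_ne_zero x
  have hxx1 : (x : ℝ) ≤ (x : ℝ) + 1 := by linarith
  -- (a) the disc majorant with the harmonic exponent, from the graded law + the envelope
  have hdisc : ∀ z : ℂ, ‖z - 1‖ ≤ R₁ → ‖P.eval z‖ ≤
      ‖P.eval 1‖ * Real.exp (Λ * (z.re - 1) + (C₁ + c₂ + 1) * (1 + ‖z - 1‖) ^ (3 / 2 : ℝ)) := by
    intro z hz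
    set r : ℝ := ‖z - 1‖ with hr
    have hr0 : 0 ≤ r := norm_nonneg _
    set φ : ℝ := (1 + r) ^ (3 / 2 : ℝ) with hφ
    have hφ1 : 1 ≤ φ := Real.one_le_rpow (by linarith) (by norm_num)
    have hφ0 : 0 ≤ φ := le_trans zero_le_one hφ1
    have hvalid : C₁ * (1 + ‖z - 1‖) ≤ Real.log (Real.log x) := by
      calc C₁ * (1 + ‖z - 1‖) ≤ C₁ * (1 + R₁) := by gcongr
        _ = Λ := hC₁R₁
    have hLz := hL x hx3 z hvalid
    have hEz := hE z
    -- name the pieces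
    set S : ℂ := ∑ n ∈ Finset.range (x + 1), z ^ (n.factorization.sum fun _ v => min v 2) with hS
    set G : ℂ := (∏' p : Nat.Primes, (1 + z / ((p : ℕ) : ℂ) + z ^ 2 / (((p : ℕ) : ℂ) * (((p : ℕ) : ℂ) - 1))) *
                Complex.exp (z * (Real.log (1 - 1 / ((p : ℕ) : ℝ)) : ℂ))) * (Complex.Gamma z)⁻¹ with hG
    set M : ℂ := (x : ℂ) * Complex.exp ((z - 1) * (Λ : ℂ)) * G with hM
    have hre : ((z - 1) * (Λ : ℂ)).re = (z.re - 1) * Λ := by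
      simp [Complex.mul_re]
    have hMnorm : ‖M‖ = x * Real.exp ((z.re - 1) * Λ) * ‖G‖ := by
      rw [hM, norm_mul, norm_mul, Complex.norm_natCast, Complex.norm_exp, hre]
    have hE' : ‖G‖ ≤ Real.exp (c₂ * φ) := by
      refine hEz.trans (Real.exp_le_exp.2 ?_)
      exact mul_le_mul_of_nonneg_right (le_max_left _ _) hφ0
    have hErr : ‖S - M‖ ≤ Real.exp (C₁ * φ) * x * Real.exp ((z.re - 1) * Λ) := by
      refine hLz.trans ?_
      exact div_le_self (by positivity) hlogx1
    have hSeval : P.eval z = S := eval_eq x z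
    calc ‖P.eval z‖ = ‖S‖ := by rw [hSeval]
      _ = ‖M + (S - M)‖ := by rw [add_sub_cancel]
      _ ≤ ‖M‖ + ‖S - M‖ := norm_add_le _ _
      _ ≤ x * Real.exp ((z.re - 1) * Λ) * Real.exp (c₂ * φ) +
            Real.exp (C₁ * φ) * x * Real.exp ((z.re - 1) * Λ) := by
          rw [hMnorm]; gcongr
      _ = x * Real.exp ((z.re - 1) * Λ) * (Real.exp (c₂ * φ) + Real.exp (C₁ * φ)) := by ring
      _ ≤ ((x : ℝ) + 1) * Real.exp ((z.re - 1) * Λ) * Real.exp ((C₁ + c₂ + 1) * φ) := by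
          gcongr
          exact exp_add_exp_le hC₁0 hc₂0 hφ1
      _ = ‖P.eval 1‖ * Real.exp (Λ * (z.re - 1) + (C₁ + c₂ + 1) * (1 + ‖z - 1‖) ^ (3 / 2 : ℝ)) := by
          rw [hP1norm, Real.exp_add, ← hφ, mul_comm Λ (z.re - 1)]; ring
  -- (b) the crude global majorant, from positivity + Rankin
  have hglob : ∀ z : ℂ, ‖P.eval z‖ ≤
      ‖P.eval 1‖ * Real.exp (Λ * ‖z - 1‖ + 2 * b * (1 + ‖z - 1‖) ^ (3 / 2 : ℝ)) := by
    intro z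
    set r : ℝ := ‖z - 1‖ with hr
    have hr0 : 0 ≤ r := norm_nonneg _
    set φ : ℝ := (1 + r) ^ (3 / 2 : ℝ) with hφ
    have hφ1 : 1 ≤ φ := Real.one_le_rpow (by linarith) (by norm_num)
    have hz1 : ‖z‖ ≤ 1 + r := by
      calc ‖z‖ = ‖(z - 1) + 1‖ := by rw [sub_add_cancel]
        _ ≤ ‖z - 1‖ + ‖(1 : ℂ)‖ := norm_add_le _ _
        _ = 1 + r := by rw [norm_one, hr, add_comm]
    have hRz := hR x hx3 r hr0
    calc ‖P.eval z‖ = ‖∑ n ∈ Finset.range (x + 1), z ^ (n.factorization.sum fun _ v => min v 2)‖ := by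
            rw [eval_eq]
      _ ≤ ∑ n ∈ Finset.range (x + 1), ‖z ^ (n.factorization.sum fun _ v => min v 2)‖ := norm_sum_le _ _
      _ = ∑ n ∈ Finset.range (x + 1), ‖z‖ ^ (n.factorization.sum fun _ v => min v 2) := by
            simp_rw [norm_pow]
      _ ≤ ∑ n ∈ Finset.range (x + 1), (1 + r) ^ (n.factorization.sum fun _ v => min v 2) := by
            gcongr with n _
      _ ≤ B * x * Real.exp (Λ * r + B * φ) := hRz
      _ ≤ b * x * Real.exp (Λ * r + B * φ) := by
            gcongr
      _ = x * (b * Real.exp (Λ * r + B * φ)) := by ring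
      _ ≤ x * Real.exp (Λ * r + 2 * b * φ) := by
            gcongr
            exact mul_exp_le hBb hb1 hφ1
      _ ≤ ((x : ℝ) + 1) * Real.exp (Λ * r + 2 * b * φ) := by gcongr
      _ = ‖P.eval 1‖ * Real.exp (Λ * ‖z - 1‖ + 2 * b * (1 + ‖z - 1‖) ^ (3 / 2 : ℝ)) := by
            rw [hP1norm]
  have hfin := hK P Λ R₁ hP1ne hR₁1 hΛ0 hΛk hdisc hglob
  exact hfin.trans (le_max_right _ _)

/-- **THE COMPOSITION.** `LinearCappedRepulsion` BY NAME from the stubs S1–S4 (sorry only inside `stub_*`). -/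
theorem LinearCappedRepulsion_of : LinearCappedRepulsion :=
  repulsion_of_parts stub_gradedLSD stub_limitEnvelope stub_rankinMajorant stub_jensenConversion

end Summit.Parity.BatemanHorn.Cruxes.LinearCappedRepulsion.GradedLsdRouche

end
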